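import Mathlib
import HarnessLib
import Summits.Ventures.LatticeQCDFlow.Exactness.U1ExpChartMinorisation
import Summits.Ventures.LatticeQCDFlow.Exactness.SphereSpreading

/-!
# Box-uniform kicks cover `U(1)`: the sum of `2^j` uniform kicks of size `a` dominates Lebesgue on `|θ| < (3/2)^j a`

HONEST FRAMING: exact (Metropolis-corrected) sampling algorithms for lattice gauge theory;
figures of merit are autocorrelation/cost numbers at stated couplings and volumes; no
continuum-physics claim.

Venture `LatticeQCDFlow` (cell pub-lqcd), topic `Exactness`, FANOUT row 9 (eng-latcore; the
engine path concerned is the N-hit Metropolis link update of `latflow.core.u1_2d.U1Field2D.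
sweep_metropolis(β, step, nhit)`: proposals `θ ← θ + step·U[−1,1]`).  NEW WORK of the cell over
Mathlib (`Measure.conv`, `Measure.prod_apply`, `lintegral_lintegral_swap`, translation invariance
of Lebesgue measure) and the tree's `U1ExpChartMinorisation.lean`; nothing here is cited as a fact.

WHY.  A Doeblin certificate for a SMALL-STEP random-walk Metropolis needs the law of the product of
many kicks to dominate a multiple of Haar measure.  On `U(1)` the kicks commute, `e^{iθ₂}e^{iθ₁} =
e^{i(θ₁+θ₂)}`, so this is a statement about real-line convolution powers of the box law, pushed to
the circle.  This file proves the covering lemma with explicit (if poor) constants by DOUBLING: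

* §1 `conv_mono'`, `smul_conv_smul` — convolution of measures is monotone and bilinear in scalars;
* §2 **`smul_restrict_ball_le_conv`** — `(a/2) · dθ|_{|θ|<3a/2} ≤ dθ|_{|θ|<a} ∗ dθ|_{|θ|<a}` for
  `a > 0` (the fibre `{x : |x| < a, |z − x| < a}` contains the interval of length `a/2` centred at
  `z/2` whenever `|z| < 3a/2`; Tonelli);
* §3 `convDouble μ j` — the law-type measure of the sum of `2^j` independent `μ`-kicks
  (`convDouble μ (j+1) = convDouble μ j ∗ convDouble μ j`); **`smul_restrict_ball_le_convDouble`** —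
  `c_j(a) · dθ|_{|θ|<(3/2)^j a} ≤ convDouble (dθ|_{|θ|<a}) j` with `c_j(a) > 0` explicit
  (`doublingConst`);
* §4 **`exists_smul_haar_le_map_convDouble`** — for every `a > 0` there are `j` and `c > 0` with
  `c • Haar_{U(1)} ≤ (convDouble (dθ|_{|θ|<a}) j) ∘ (θ ↦ e^{iθ}·u)⁻¹` for EVERY `u ∈ U(1)`: after
  `2^j` kicks (`(3/2)^j a ≥ π`) the kicked link dominates a multiple of Haar measure, uniformly in
  its starting value.

NOT here: the Metropolis accept/reject bookkeeping over hits, links and sweeps that turns §4 into a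
Doeblin minorant of `sweep_metropolis` (the all-accept event has probability `≥ e^{−2β·(#hits)}`-type
bounds; to be assembled with `RefreshScan.comp_minorised`); `SU(2)` (kicks do not commute — a
group-convolution covering lemma is needed there and is not in the tree); sharp constants.
-/

noncomputable section

namespace Summit.Ventures.LatticeQCDFlow.Exactness

open MeasureTheory Measure Set Metric
open Literature.MathematicalPhysics.QuantumFieldTheory (haarProbability)
open scoped ENNReal

/-! ## §1 Convolution of measures: monotone, bilinear in scalars -/

section Conv

variable {G : Type*} [AddCommGroup G] [MeasurableSpace G] [MeasurableAdd₂ G]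

/-- Convolution of measures is monotone in both arguments. -/
theorem conv_mono' {μ μ' ν ν' : Measure G} [SFinite ν'] (h1 : μ ≤ μ') (h2 : ν ≤ ν') :
    μ ∗ ν ≤ μ' ∗ ν' := by
  unfold Measure.conv
  exact Measure.map_mono (Measure.prod_mono h1 h2) measurable_add

omit [MeasurableAdd₂ G] in
/-- Scalars pull out of both arguments of a convolution. -/
theorem smul_conv_smul (μ ν : Measure G) [SFinite μ] [SFinite ν] (c d : ℝ≥0∞) :
    (c • μ) ∗ (d • ν) = (c * d) • (μ ∗ ν) := by
  unfold Measure.conv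
  rw [Measure.prod_smul_left, Measure.prod_smul_right, smul_smul, Measure.map_smul]

end Conv

/-! ## §2 The doubling inequality on the line -/

/-- The fibre of the sum over a point `z` with `|z| < 3a/2` contains the interval of length `a/2`
centred at `z/2`: `ball (z/2) (a/4) ⊆ {x : |x| < a ∧ |z − x| < a}`. -/
theorem ball_half_subset_fibre {a z : ℝ} (hz : z ∈ ball (0 : ℝ) (3 * a / 2)) :
    ball (z / 2) (a / 4) ⊆ {x : ℝ | x ∈ ball (0 : ℝ) a ∧ z - x ∈ ball (0 : ℝ) a} := by
  intro x hx
  rw [mem_ball_zero_iff, Real.norm_eq_abs] at hz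
  rw [mem_ball, Real.dist_eq] at hx
  simp only [mem_setOf_eq, mem_ball_zero_iff, Real.norm_eq_abs]
  constructor
  · calc |x| = |(x - z / 2) + z / 2| := by ring_nf
      _ ≤ |x - z / 2| + |z / 2| := abs_add_le _ _
      _ < a / 4 + 3 * a / 4 := by
          refine add_lt_add hx ?_
          rw [abs_div, abs_two]
          linarith
      _ = a := by ring
  · calc |z - x| = |z / 2 - (x - z / 2)| := by ring_nf
      _ ≤ |z / 2| + |x - z / 2| := abs_sub _ _
      _ < 3 * a / 4 + a / 4 := by
          refine add_lt_add ?_ hx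
          rw [abs_div, abs_two]
          linarith
      _ = a := by ring

/-- **The doubling inequality**: `(a/2) · dθ|_{|θ|<3a/2} ≤ dθ|_{|θ|<a} ∗ dθ|_{|θ|<a}` for `a > 0`. -/
theorem smul_restrict_ball_le_conv (a : ℝ) :
    ENNReal.ofReal (a / 2) • volume.restrict (ball (0 : ℝ) (3 * a / 2)) ≤
      volume.restrict (ball (0 : ℝ) a) ∗ volume.restrict (ball (0 : ℝ) a) := by
  refine Measure.le_iff.2 fun A hA => ?_
  have hpre : MeasurableSet ((fun p : ℝ × ℝ => p.1 + p.2) ⁻¹' A) := measurable_add hA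
  rw [Measure.smul_apply, smul_eq_mul, Measure.restrict_apply hA, Measure.conv,
    Measure.map_apply measurable_add hA, Measure.prod_apply hpre]
  -- the inner fibre measure: `vol|_{|y|<a} {y : x + y ∈ A} = ∫ 1_A(z) 1_{|z−x|<a} dz`
  have hinner : ∀ x : ℝ, volume.restrict (ball (0 : ℝ) a)
      (Prod.mk x ⁻¹' ((fun p : ℝ × ℝ => p.1 + p.2) ⁻¹' A)) =
      ∫⁻ z, A.indicator 1 z * {z : ℝ | z - x ∈ ball (0 : ℝ) a}.indicator 1 z := by
    intro x
    have hset : Prod.mk x ⁻¹' ((fun p : ℝ × ℝ => p.1 + p.2) ⁻¹' A) = (fun y => x + y) ⁻¹' A := rfl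
    have hmeasS : MeasurableSet {z : ℝ | z - x ∈ ball (0 : ℝ) a} :=
      measurableSet_ball.preimage (measurable_id.sub measurable_const)
    have hset2 : (fun y => x + y) ⁻¹' A ∩ ball (0 : ℝ) a =
        (fun y => x + y) ⁻¹' (A ∩ {z : ℝ | z - x ∈ ball (0 : ℝ) a}) := by
      ext y
      simp [add_sub_cancel_left]
    rw [hset, Measure.restrict_apply' measurableSet_ball, hset2, measure_preimage_add,
      ← lintegral_indicator_one (hA.inter hmeasS)]
    refine lintegral_congr fun z => ?_
    by_cases h1 : z ∈ A
    · by_cases h2 : z ∈ {z : ℝ | z - x ∈ ball (0 : ℝ) a}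
      · rw [indicator_of_mem (show z ∈ A ∩ {z : ℝ | z - x ∈ ball (0 : ℝ) a} from ⟨h1, h2⟩),
          indicator_of_mem h1, indicator_of_mem h2]
        simp
      · rw [indicator_of_notMem (show z ∉ A ∩ {z : ℝ | z - x ∈ ball (0 : ℝ) a} from fun h => h2 h.2),
          indicator_of_notMem h2, mul_zero]
    · rw [indicator_of_notMem (show z ∉ A ∩ {z : ℝ | z - x ∈ ball (0 : ℝ) a} from fun h => h1 h.1),
        indicator_of_notMem h1, zero_mul]
  simp_rw [hinner]
  -- the outer restricted integral as an indicator-weighted integral, then Tonelli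
  rw [← lintegral_indicator measurableSet_ball]
  have hind : ∀ x : ℝ, (ball (0 : ℝ) a).indicator
      (fun x => ∫⁻ z, A.indicator (1 : ℝ → ℝ≥0∞) z * {z : ℝ | z - x ∈ ball (0 : ℝ) a}.indicator 1 z) x =
      ∫⁻ z, (ball (0 : ℝ) a).indicator (1 : ℝ → ℝ≥0∞) x *
        (A.indicator 1 z * {z : ℝ | z - x ∈ ball (0 : ℝ) a}.indicator 1 z) := by
    intro x
    by_cases hx : x ∈ ball (0 : ℝ) a
    · simp only [indicator_of_mem hx, Pi.one_apply, one_mul]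
    · simp only [indicator_of_notMem hx, zero_mul, lintegral_zero]
  rw [lintegral_congr hind]
  have hS : MeasurableSet {p : ℝ × ℝ | p.2 - p.1 ∈ ball (0 : ℝ) a} :=
    measurableSet_ball.preimage (measurable_snd.sub measurable_fst)
  have hF : Measurable fun p : ℝ × ℝ => (ball (0 : ℝ) a).indicator (1 : ℝ → ℝ≥0∞) p.1 *
      (A.indicator (1 : ℝ → ℝ≥0∞) p.2 * {z : ℝ | z - p.1 ∈ ball (0 : ℝ) a}.indicator 1 p.2) := by
    have heq : (fun p : ℝ × ℝ => ({z : ℝ | z - p.1 ∈ ball (0 : ℝ) a}).indicator (1 : ℝ → ℝ≥0∞) p.2) =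
        {p : ℝ × ℝ | p.2 - p.1 ∈ ball (0 : ℝ) a}.indicator 1 := by
      funext p
      by_cases hp : p.2 - p.1 ∈ ball (0 : ℝ) a
      · rw [indicator_of_mem (show p.2 ∈ {z : ℝ | z - p.1 ∈ ball (0 : ℝ) a} from hp),
          indicator_of_mem (show p ∈ {p : ℝ × ℝ | p.2 - p.1 ∈ ball (0 : ℝ) a} from hp)]
        rfl
      · rw [indicator_of_notMem (show p.2 ∉ {z : ℝ | z - p.1 ∈ ball (0 : ℝ) a} from hp),
          indicator_of_notMem (show p ∉ {p : ℝ × ℝ | p.2 - p.1 ∈ ball (0 : ℝ) a} from hp)]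
    refine ((measurable_one.indicator measurableSet_ball).comp measurable_fst).mul
      (((measurable_one.indicator hA).comp measurable_snd).mul ?_)
    rw [heq]
    exact measurable_one.indicator hS
  rw [lintegral_lintegral_swap hF.aemeasurable]
  -- lower bound fibrewise in `z`
  calc ENNReal.ofReal (a / 2) * volume (A ∩ ball 0 (3 * a / 2))
      = ∫⁻ z, (A ∩ ball 0 (3 * a / 2)).indicator (fun _ => ENNReal.ofReal (a / 2)) z := by
        rw [lintegral_indicator (hA.inter measurableSet_ball), setLIntegral_const, mul_comm]
    _ ≤ ∫⁻ z, ∫⁻ x, (ball (0 : ℝ) a).indicator (1 : ℝ → ℝ≥0∞) x *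
          (A.indicator (1 : ℝ → ℝ≥0∞) z * {z : ℝ | z - x ∈ ball (0 : ℝ) a}.indicator 1 z) := by
        refine lintegral_mono fun z => ?_
        by_cases hz : z ∈ A ∩ ball 0 (3 * a / 2)
        · rw [indicator_of_mem hz]
          have hsub := ball_half_subset_fibre (a := a) hz.2
          calc ENNReal.ofReal (a / 2) = volume (ball (z / 2) (a / 4)) := by
                rw [Real.volume_ball]; congr 1; ring
            _ = ∫⁻ x, (ball (z / 2) (a / 4)).indicator 1 x :=
                (lintegral_indicator_one measurableSet_ball).symm
            _ ≤ _ := lintegral_mono fun x => ?_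
          by_cases hx : x ∈ ball (z / 2) (a / 4)
          · have hx' := hsub hx
            rw [indicator_of_mem hx, indicator_of_mem hx'.1, indicator_of_mem hz.1,
              indicator_of_mem (show z ∈ {w : ℝ | w - x ∈ ball (0 : ℝ) a} from hx'.2)]
            simp
          · rw [indicator_of_notMem hx]
            exact zero_le
        · rw [indicator_of_notMem hz]
          exact zero_le

/-! ## §3 Doubling iterated: `2^j` kicks cover the interval `|θ| < (3/2)^j a` -/

/-- The law-type measure of the sum of `2^j` independent `μ`-distributed kicks:
`convDouble μ 0 = μ`, `convDouble μ (j+1) = convDouble μ j ∗ convDouble μ j`. -/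
def convDouble (μ : Measure ℝ) : ℕ → Measure ℝ
  | 0 => μ
  | j + 1 => convDouble μ j ∗ convDouble μ j

/-- `convDouble` of an s-finite measure is s-finite. -/
theorem sFinite_convDouble (μ : Measure ℝ) [SFinite μ] : ∀ j, SFinite (convDouble μ j)
  | 0 => by rw [convDouble]; infer_instance
  | j + 1 => by
      haveI := sFinite_convDouble μ j
      rw [convDouble]
      infer_instance

/-- The radius reached after `j` doublings: `r_j = (3/2)^j a`. -/
def doublingRadius (a : ℝ) (j : ℕ) : ℝ := (3 / 2) ^ j * a

/-- The constant after `j` doublings: `c₀ = 1`, `c_{j+1} = c_j² · (r_j / 2)`. -/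
def doublingConst (a : ℝ) : ℕ → ℝ≥0∞
  | 0 => 1
  | j + 1 => doublingConst a j ^ 2 * ENNReal.ofReal (doublingRadius a j / 2)

/-- `r_{j+1} = (3/2) r_j`. -/
theorem doublingRadius_succ (a : ℝ) (j : ℕ) :
    doublingRadius a (j + 1) = 3 * doublingRadius a j / 2 := by
  rw [doublingRadius, doublingRadius, pow_succ]
  ring

/-- The radii are positive for `a > 0`. -/
theorem doublingRadius_pos {a : ℝ} (ha : 0 < a) (j : ℕ) : 0 < doublingRadius a j := by
  unfold doublingRadius
  positivity

/-- The constants are non-zero for `a > 0`. -/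
theorem doublingConst_ne_zero {a : ℝ} (ha : 0 < a) : ∀ j, doublingConst a j ≠ 0
  | 0 => by rw [doublingConst]; exact one_ne_zero
  | j + 1 => by
      rw [doublingConst]
      refine mul_ne_zero (pow_ne_zero _ (doublingConst_ne_zero ha j)) ?_
      rw [Ne, ENNReal.ofReal_eq_zero, not_le]
      exact half_pos (doublingRadius_pos ha j)

/-- **`2^j` uniform kicks cover `|θ| < (3/2)^j a`**:
`c_j · dθ|_{|θ|<r_j} ≤ convDouble (dθ|_{|θ|<a}) j`. -/
theorem smul_restrict_ball_le_convDouble (a : ℝ) : ∀ j : ℕ,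
    doublingConst a j • volume.restrict (ball (0 : ℝ) (doublingRadius a j)) ≤
      convDouble (volume.restrict (ball (0 : ℝ) a)) j
  | 0 => by
      rw [doublingConst, one_smul, doublingRadius, pow_zero, one_mul, convDouble]
  | j + 1 => by
      have ih := smul_restrict_ball_le_convDouble a j
      haveI := sFinite_convDouble (volume.restrict (ball (0 : ℝ) a)) j
      rw [convDouble, doublingConst, doublingRadius_succ]
      calc (doublingConst a j ^ 2 * ENNReal.ofReal (doublingRadius a j / 2)) •
            volume.restrict (ball (0 : ℝ) (3 * doublingRadius a j / 2))
          = (doublingConst a j * doublingConst a j) •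
              (ENNReal.ofReal (doublingRadius a j / 2) •
                volume.restrict (ball (0 : ℝ) (3 * doublingRadius a j / 2))) := by
            rw [smul_smul, sq]
        _ ≤ (doublingConst a j * doublingConst a j) •
              (volume.restrict (ball (0 : ℝ) (doublingRadius a j)) ∗
                volume.restrict (ball (0 : ℝ) (doublingRadius a j))) :=
            measure_smul_le_smul_of_le (smul_restrict_ball_le_conv _) _
        _ = (doublingConst a j • volume.restrict (ball (0 : ℝ) (doublingRadius a j))) ∗
              (doublingConst a j • volume.restrict (ball (0 : ℝ) (doublingRadius a j))) :=
            (smul_conv_smul _ _ _ _).symm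
        _ ≤ convDouble (volume.restrict (ball (0 : ℝ) a)) j ∗ convDouble (volume.restrict (ball (0 : ℝ) a)) j :=
            conv_mono' ih ih

/-! ## §4 On the circle: enough kicks dominate a multiple of Haar measure, uniformly in the start -/

/-- **Box-uniform kicks cover `U(1)`.**  For every kick size `a > 0` there are `j` and `c > 0` such
that for EVERY starting link value `u`, the law-type measure of `e^{i(θ₁+⋯+θ_{2^j})}·u` with the
`θ_i` carrying Lebesgue measure on `|θ| < a` dominates `c •` Haar:
`c • Haar ≤ (convDouble (dθ|_{|θ|<a}) j) ∘ (θ ↦ e^{iθ}·u)⁻¹`. -/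
theorem exists_smul_haar_le_map_convDouble {a : ℝ} (ha : 0 < a) :
    ∃ j : ℕ, ∃ c : ℝ≥0∞, 0 < c ∧ ∀ u : Circle,
      c • haarProbability Circle ≤
        (convDouble (volume.restrict (ball (0 : ℝ) a)) j).map (fun θ : ℝ => Circle.exp θ * u) := by
  obtain ⟨j, hj⟩ := pow_unbounded_of_one_lt (Real.pi / a) (by norm_num : (1 : ℝ) < 3 / 2)
  have hr : Real.pi ≤ doublingRadius a j := by
    rw [doublingRadius]
    exact ((div_lt_iff₀ ha).1 hj).le
  refine ⟨j, doublingConst a j * ENNReal.ofReal (2 * Real.pi),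
    ENNReal.mul_pos (doublingConst_ne_zero ha j)
      (by rw [Ne, ENNReal.ofReal_eq_zero, not_le]; positivity), fun u => ?_⟩
  have hf : Measurable fun θ : ℝ => Circle.exp θ * u :=
    (Circle.exp.continuous.mul continuous_const).measurable
  have hmu : Measurable fun g : Circle => g * u := measurable_mul_const u
  have hcomp : (fun θ : ℝ => Circle.exp θ * u) = (fun g : Circle => g * u) ∘ Circle.exp := rfl
  calc (doublingConst a j * ENNReal.ofReal (2 * Real.pi)) • haarProbability Circle
      = doublingConst a j • ((ENNReal.ofReal (2 * Real.pi) • haarProbability Circle).map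
          (fun g : Circle => g * u)) := by
        rw [Measure.map_smul, map_mul_right_eq_self, smul_smul]
    _ = doublingConst a j • (volume.restrict (ball (0 : ℝ) Real.pi)).map (fun θ : ℝ => Circle.exp θ * u) := by
        rw [smul_haarProbability_circle_eq_map_exp, Measure.map_map hmu Circle.exp.continuous.measurable,
          ← hcomp]
    _ ≤ doublingConst a j • (volume.restrict (ball (0 : ℝ) (doublingRadius a j))).map
          (fun θ : ℝ => Circle.exp θ * u) :=
        measure_smul_le_smul_of_le
          (Measure.map_mono (Measure.restrict_mono (ball_subset_ball hr) le_rfl) hf) _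
    _ = (doublingConst a j • volume.restrict (ball (0 : ℝ) (doublingRadius a j))).map
          (fun θ : ℝ => Circle.exp θ * u) := (Measure.map_smul _ _ _).symm
    _ ≤ (convDouble (volume.restrict (ball (0 : ℝ) a)) j).map (fun θ : ℝ => Circle.exp θ * u) :=
        Measure.map_mono (smul_restrict_ball_le_convDouble a j) hf

end Summit.Ventures.LatticeQCDFlow.Exactness
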